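import Summits.AtomisticToContinuum.Crystallization.Theorems.OverbindingBudgetAffineNearPricedWalls

/-!
(SPLIT FOR THE 400-LINE CAP by the landing lane, hand-2 g34: this file = part 1 of 2; sequels `…OverbindingBudgetAffineNearCollarCut` import it in a chain; same namespace, all FQNs unchanged.)
# Overbinding budget — COLLAR CUT: the extremal re-cut R0ᴬ ⟸ RC ∧ RS of the priced skeleton floor (decomp-a2c lens-4, generation 73)

Child of `…Theorems.OverbindingBudgetAffineNearPricedWalls` (lens-4 g72, critic row 1286 CLEARED + LANDING GO; GEN 72P: R0⁻ ⟸ R0ᴬ ∧ FC beneath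
71L RD0c ⟸ CP⁺ ∧ R0⁻, tree `…Theorems.OverbindingBudgetAffineNearLightSkeleton`, p852495).
Memo: `HOME/decomp-a2c-lens-4/g73/memo/NODE-g73-CollarCut.md`.  Probes: `HOME/decomp-a2c-lens-4/g73/bc/probes_collar.lean`, `bc7_collar.lean`.

## The extremal question and its answer
R0ᴬ `NearPricedSkeletonFloor` (NEW g72 · UNDECIDED · ATTACKABLE-L; the heavy near-regime leaf of 31280 slot 3) floors the class energy of EVERY
admissible skeleton equilibrium `(F, z)` of `y` — relaxed cells, PRICED deep walls, CREDITED raw collar — as ONE GLOBAL SUM over the near class.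
g72 memo §4 (critic 1286 (b): concur) showed WHY it is global: the sitewise Cauchy–Born expansion carries a null-Lagrangian term, first order in
the strain gradient, whose sum over any region is a FACE FLUX through the region's boundary; a region deep in near matter has no budget of that
order (blockwise / one-box floors are FALSE-type).  Lens-4 now asks the complementary extremal question: ONTO WHICH regions DOES a skeleton floor
localise?  Answer of this node: exactly onto regions whose boundary layer is COUNT-CHARGEABLE to far/bad matter — and the maximal such
localisation is ONE cut surface at `y`-distance `D(ℓ) := 2ℓ + 2Rc` from the non-near matter:
* `nearCore D` := the near sites all of whose sites within `D` are near; `nearShell D` := the other near sites.  PROVED STRUCTURE (from the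
  definitions alone): `nearCore (2ℓ+2Rc) ⊆ F ∪ wallZone` — the core consists of RELAXED CELL SITES AND PRICED DEEP-WALL ZONES ONLY
  (`nearCore_subset_free_union_wallZone`); `collarPinned ⊆ nearShell (2ℓ+2Rc)` — the credited raw collar lies in the shell
  (`collarPinned_subset_nearShell`); the empty skeleton of thin near matter has EMPTY core (`nearCore_eq_empty_of_deepPinned_empty`).
* RC · `NearPricedCoreFloor η R Rc δm ρ₁ θ θ₀ κ t w rL` [NEW · TRUE-type on paper · ATTACKABLE-L · UNDECIDED — the BULK theorem]: for every
  admissible skeleton equilibrium, `#core·e⋆ − C·#Gᶜ − κ·#Far − ν·Q₁(core) − A·Σ_{W ∩ core} forceContent y ≤ ½·pairSum core G z` — NO collar,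
  NO credit, NO near/far interface, NO tails against incoherent matter inside `D`: cells and priced walls, with the cut flux at depth `D(ℓ)`
  charged to `κ·#Far + C·#Gᶜ` (cut layer `≤ C(ℓ, δ)·(#Far + #Gᶜ)` sites by packing; flux per site `O(ε₁·poly ℓ)` by registration and the
  cell equilibria's gradient bound, or dominated by the near-side strain surplus `c_W θ₀²/4` per site next to thin far bands, where the near
  matter on both sides of the cut is strained `≥ θ₀/2` over `θ₀/(Cε₁) ≫ D` layers).  Independent of the collar-credit question (census ⑨b).
* RS · `NearPricedShellFloor η R Rc δm ρ₁ θ θ₀ κ t w rL` [NEW · TRUE-type on paper · ATTACKABLE-M · UNDECIDED · INSTRUMENTABLE (⑨b) — the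
  COLLAR theorem]: `#shell·e⋆ − C·#Gᶜ − κ·#Far − ν·Q₁(shell) − A·Σ_{W ∩ shell} forceContent y + cE·Σ_{collar-pinned} forceContent y
  ≤ ½·pairSum shell G z` — the telescoped interface flux, the near-side tails against far/bad matter (slot Z's wall lemma), the class-asymmetry
  force content of far-adjacent collar sites (`‖classForce (Near, G) y‖ ≈ |F^{Far}| ≈ Rc⁻⁴` even for equilibrated `y`: near–near bonds count
  twice, near–far once), and the Polyak–Łojasiewicz credit of raw REGISTERED pinned matter (critic 1286 (c): every credited site is
  `AffDeepReg`, `affDeepReg_of_mem_collarPinned`) all live here, at bounded distance `2ℓ + 2Rc` from budgeted matter.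
* GLUE (PROVED, `nearPricedSkeletonFloor_of_core_of_shell`): every atom of R0ᴬ is ADDITIVE over `Near = core ⊔ shell` (cards, `pairSum`, `Q₁`,
  the wall price; the credit is the shell's); `A := max`, `cE := cE_shell`, `ℓ₀ := max`, `ε₀ := min`, `C := C_c + C_s`, `κ_c + κ_s ≤ κ`:
  RC(κ₁/4) ∧ RS(κ₁/4) ⟹ R0ᴬ(κ₁/2) ⟹ (g72) R0⁻ ⟹ RD0c; LINE cone `K_at⁰ ∧ R_aff ∧ CP⁺ ∧ RC ∧ RS ∧ FC ∧ N2 ∧ Z ∧ M ⟹ TBDSG_rec` through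
  g72's `tbdsg_of_nearPricedFloor_record` and the cone of record (UNCHANGED); RDEF shape.
* NOT REWORDINGS (probes): RC ↛ R0ᴬ, RS ↛ R0ᴬ (each floors one sub-class), R0ᴬ ↛ RC and R0ᴬ ↛ RS (a shell surplus may mask a core deficit in
  the global sum: incomparable as typed), neither ⇒ R0⁻ / RD0c, neither outright nor refutable by the battery; PROVED: the glue, the structure
  lemmas, the degenerate consistency `corePricedFloor_ineq_of_nearCore_eq_empty` (RC's inequality on thin near matter).
WHY NOVEL: the first cut of a skeleton floor ALONG A SURFACE, placed by the barrier analysis itself (count-chargeable boundary ⇔ within `D(ℓ)`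
of far/bad matter); it confines the ⑨b-dependent credit and the whole interface analysis to RS and leaves a credit-free, interface-free bulk
floor RC whose Lean/prover work need not wait for census ⑨b.  WHY STRICTLY WEAKER: RC and RS each floor a proper sub-class with their own
budgets; neither is implied by R0ᴬ (global compensation) nor implies it (silent on the other sub-class); their conjunction implies it (PROVED).
sorry-free · Mathlib + tree only · no new axioms · no instance / notation beyond the tree's local `E3`.
-/

namespace Summit.AtomisticToContinuum.Crystallization.Theorems.OverbindingBudgetAffineNearCluster

open scoped BigOperators Classical
open Literature.MathematicalPhysics.StatisticalMechanics
open Literature.Geometry.DiscreteGeometry (nearestDist)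
open Summit.AtomisticToContinuum.Crystallization.Theorems.OverbindingBudgetMisfitWindowStatements (InWindow)
open Summit.AtomisticToContinuum.Crystallization.Theses.OverbindingBudget (RobustDefectLimitWindows)
open Summit.AtomisticToContinuum.Crystallization.Theses.PricedLinkCensus (ChargedEnergyGap)
open Summit.AtomisticToContinuum.Crystallization.Theorems.OverbindingBudgetGradedBareness (CleanlessExcessT)
open Summit.AtomisticToContinuum.Crystallization.Theorems.OverbindingBudgetCoherentCut (CoherentResidual)
open Summit.AtomisticToContinuum.Crystallization.Theorems.OverbindingBudgetTwoShellShape (TwoShellShape)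
open Summit.AtomisticToContinuum.Crystallization.Theorems.OverbindingBudgetBalancedCensusStatements
open Summit.AtomisticToContinuum.Crystallization.Theorems.OverbindingBudgetBalancedCensusRecord
open Summit.AtomisticToContinuum.Crystallization.Theorems.OverbindingBudgetHarmonicNormalForm
open Summit.AtomisticToContinuum.Crystallization.Theorems.OverbindingBudgetLocalHarmonicCertificate
open Summit.AtomisticToContinuum.Crystallization.Theorems.OverbindingBudgetAffineLadder
open Summit.AtomisticToContinuum.Crystallization.Theorems.OverbindingBudgetAffineLocalisation

variable {N : ℕ}
local notation "E3" => EuclideanSpace ℝ (Fin 3)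

/-! ## §1  The core / shell split of the near class at radius `D` (PROVED bookkeeping) -/

/-- **Near CORE at radius `D`**: the near sites all of whose sites within `y`-distance `D` are near (no far or bad matter within `D`). [this file] -/
noncomputable def nearCore (D θ₀ ρ₁ ε₁ θ δ : ℝ) (y : Fin N → E3) : Finset (Fin N) :=
  (nearSet θ₀ ρ₁ ε₁ θ δ y).filter fun i => ∀ j, dist (y j) (y i) ≤ D → j ∈ nearSet θ₀ ρ₁ ε₁ θ δ y

/-- **Near SHELL at radius `D`**: the near sites with a non-near (far or bad) site within `y`-distance `D`. [this file] -/
noncomputable def nearShell (D θ₀ ρ₁ ε₁ θ δ : ℝ) (y : Fin N → E3) : Finset (Fin N) :=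
  (nearSet θ₀ ρ₁ ε₁ θ δ y).filter fun i => ¬ ∀ j, dist (y j) (y i) ≤ D → j ∈ nearSet θ₀ ρ₁ ε₁ θ δ y

/-- Membership in the core. [formal bookkeeping] -/
theorem mem_nearCore {D θ₀ ρ₁ ε₁ θ δ : ℝ} {y : Fin N → E3} {i : Fin N} :
    i ∈ nearCore D θ₀ ρ₁ ε₁ θ δ y ↔
      i ∈ nearSet θ₀ ρ₁ ε₁ θ δ y ∧ ∀ j, dist (y j) (y i) ≤ D → j ∈ nearSet θ₀ ρ₁ ε₁ θ δ y := by
  unfold nearCore; rw [Finset.mem_filter]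

/-- Membership in the shell (negated-core form). [formal bookkeeping] -/
theorem mem_nearShell_iff {D θ₀ ρ₁ ε₁ θ δ : ℝ} {y : Fin N → E3} {i : Fin N} :
    i ∈ nearShell D θ₀ ρ₁ ε₁ θ δ y ↔
      i ∈ nearSet θ₀ ρ₁ ε₁ θ δ y ∧ ¬ ∀ j, dist (y j) (y i) ≤ D → j ∈ nearSet θ₀ ρ₁ ε₁ θ δ y := by
  unfold nearShell; rw [Finset.mem_filter]

/-- A shell site is a near site with a NON-NEAR site within `D`. [this file] -/
theorem mem_nearShell {D θ₀ ρ₁ ε₁ θ δ : ℝ} {y : Fin N → E3} {i : Fin N} :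
    i ∈ nearShell D θ₀ ρ₁ ε₁ θ δ y ↔
      i ∈ nearSet θ₀ ρ₁ ε₁ θ δ y ∧ ∃ j, j ∉ nearSet θ₀ ρ₁ ε₁ θ δ y ∧ dist (y j) (y i) ≤ D := by
  rw [mem_nearShell_iff]
  constructor
  · rintro ⟨hi, h⟩
    push Not at h
    obtain ⟨j, hj, hjn⟩ := h
    exact ⟨hi, j, hjn, hj⟩
  · rintro ⟨hi, j, hjn, hj⟩
    exact ⟨hi, fun h => hjn (h j hj)⟩

/-- The core lies in the near class. [formal bookkeeping] -/
theorem nearCore_subset (D θ₀ ρ₁ ε₁ θ δ : ℝ) (y : Fin N → E3) : nearCore D θ₀ ρ₁ ε₁ θ δ y ⊆ nearSet θ₀ ρ₁ ε₁ θ δ y :=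
  Finset.filter_subset _ _

/-- The shell lies in the near class. [formal bookkeeping] -/
theorem nearShell_subset (D θ₀ ρ₁ ε₁ θ δ : ℝ) (y : Fin N → E3) : nearShell D θ₀ ρ₁ ε₁ θ δ y ⊆ nearSet θ₀ ρ₁ ε₁ θ δ y :=
  Finset.filter_subset _ _

/-- Core and shell are disjoint. [formal bookkeeping] -/
theorem disjoint_nearCore_nearShell (D θ₀ ρ₁ ε₁ θ δ : ℝ) (y : Fin N → E3) :
    Disjoint (nearCore D θ₀ ρ₁ ε₁ θ δ y) (nearShell D θ₀ ρ₁ ε₁ θ δ y) :=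
  Finset.disjoint_left.mpr fun _ h1 h2 => (mem_nearShell_iff.mp h2).2 (mem_nearCore.mp h1).2

/-- `Near = core ⊔ shell`. [this file] -/
theorem nearCore_union_nearShell (D θ₀ ρ₁ ε₁ θ δ : ℝ) (y : Fin N → E3) :
    nearCore D θ₀ ρ₁ ε₁ θ δ y ∪ nearShell D θ₀ ρ₁ ε₁ θ δ y = nearSet θ₀ ρ₁ ε₁ θ δ y := by
  ext i
  rw [Finset.mem_union, mem_nearCore, mem_nearShell_iff]
  constructor
  · rintro (⟨hi, -⟩ | ⟨hi, -⟩) <;> exact hi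
  · intro hi
    by_cases h : ∀ j, dist (y j) (y i) ≤ D → j ∈ nearSet θ₀ ρ₁ ε₁ θ δ y
    · exact Or.inl ⟨hi, h⟩
    · exact Or.inr ⟨hi, h⟩

/-- For a near site, «in the shell» is «not in the core». [this file] -/
theorem mem_nearShell_iff_not_mem_nearCore {D θ₀ ρ₁ ε₁ θ δ : ℝ} {y : Fin N → E3} {i : Fin N}
    (hi : i ∈ nearSet θ₀ ρ₁ ε₁ θ δ y) : i ∈ nearShell D θ₀ ρ₁ ε₁ θ δ y ↔ i ∉ nearCore D θ₀ ρ₁ ε₁ θ δ y := by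
  rw [mem_nearShell_iff, mem_nearCore]
  tauto

/-- **ADDITIVITY of the atoms of R0ᴬ over `core ⊔ shell` (PROVED)**: cards. [this file] -/
theorem card_nearSet_eq_core_add_shell (D θ₀ ρ₁ ε₁ θ δ : ℝ) (y : Fin N → E3) :
    ((nearSet θ₀ ρ₁ ε₁ θ δ y).card : ℝ) = ((nearCore D θ₀ ρ₁ ε₁ θ δ y).card : ℝ) + ((nearShell D θ₀ ρ₁ ε₁ θ δ y).card : ℝ) := by
  rw [← nearCore_union_nearShell D θ₀ ρ₁ ε₁ θ δ y, Finset.card_union_of_disjoint (disjoint_nearCore_nearShell D θ₀ ρ₁ ε₁ θ δ y)]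
  push_cast
  ring

/-- Additivity: the class pair sum in its first class. [this file] -/
theorem pairSum_nearSet_eq_core_add_shell (D θ₀ ρ₁ ε₁ θ δ : ℝ) (T : Finset (Fin N)) (y z : Fin N → E3) :
    pairSum (nearSet θ₀ ρ₁ ε₁ θ δ y) T z = pairSum (nearCore D θ₀ ρ₁ ε₁ θ δ y) T z + pairSum (nearShell D θ₀ ρ₁ ε₁ θ δ y) T z := by
  unfold pairSum
  rw [← Finset.sum_union (disjoint_nearCore_nearShell D θ₀ ρ₁ ε₁ θ δ y), nearCore_union_nearShell]

/-- Additivity: the displacement-gradient form in its first class. [this file] -/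
theorem dispGradSum_nearSet_eq_core_add_shell (Rg D θ₀ ρ₁ ε₁ θ δ : ℝ) (T : Finset (Fin N)) (y x z : Fin N → E3) :
    dispGradSum Rg (nearSet θ₀ ρ₁ ε₁ θ δ y) T x z
      = dispGradSum Rg (nearCore D θ₀ ρ₁ ε₁ θ δ y) T x z + dispGradSum Rg (nearShell D θ₀ ρ₁ ε₁ θ δ y) T x z := by
  unfold dispGradSum
  rw [← Finset.sum_union (disjoint_nearCore_nearShell D θ₀ ρ₁ ε₁ θ δ y), nearCore_union_nearShell]

/-- The clampable interior lies in the near class. [this file] -/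
theorem nearInterior_subset_nearSet (Rc θ₀ ρ₁ ε₁ θ δ : ℝ) (y : Fin N → E3) :
    nearInterior Rc θ₀ ρ₁ ε₁ θ δ y ⊆ nearSet θ₀ ρ₁ ε₁ θ δ y :=
  Finset.filter_subset _ _

/-- Additivity: a sum over the wall zone splits into its core part and its shell part. [this file] -/
theorem sum_wallZone_eq_core_add_shell (ℓ rL Rc θ₀ ρ₁ ε₁ θ δ D : ℝ) (y : Fin N → E3) (F : Finset (Fin N)) (f : Fin N → ℝ) :
    ∑ j ∈ wallZone ℓ rL Rc θ₀ ρ₁ ε₁ θ δ y F, f j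
      = (∑ j ∈ (wallZone ℓ rL Rc θ₀ ρ₁ ε₁ θ δ y F).filter (fun j => j ∈ nearCore D θ₀ ρ₁ ε₁ θ δ y), f j)
        + ∑ j ∈ (wallZone ℓ rL Rc θ₀ ρ₁ ε₁ θ δ y F).filter (fun j => j ∈ nearShell D θ₀ ρ₁ ε₁ θ δ y), f j := by
  rw [← Finset.sum_filter_add_sum_filter_not (wallZone ℓ rL Rc θ₀ ρ₁ ε₁ θ δ y F) (fun j => j ∈ nearCore D θ₀ ρ₁ ε₁ θ δ y) f]
  congr 1
  refine Finset.sum_congr (Finset.filter_congr fun j hj => ?_) fun _ _ => rfl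
  have hjN : j ∈ nearSet θ₀ ρ₁ ε₁ θ δ y :=
    nearInterior_subset_nearSet Rc θ₀ ρ₁ ε₁ θ δ y (wallZone_subset ℓ rL Rc θ₀ ρ₁ ε₁ θ δ y F hj)
  exact (mem_nearShell_iff_not_mem_nearCore hjN).symm

/-! ## §2  Structure of the cut at `D = 2ℓ + 2Rc` (PROVED from the definitions: no skeleton clause is needed) -/

/-- Near sites have own nearest-neighbour distance `≤ 2` (the window). [this file] -/
theorem nearestDist_le_two_of_mem_nearSet {θ₀ ρ₁ ε₁ θ δ : ℝ} {y : Fin N → E3} {i : Fin N}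
    (hi : i ∈ nearSet θ₀ ρ₁ ε₁ θ δ y) : nearestDist y i ≤ 2 := by
  unfold nearSet goodSet at hi
  simp only [Finset.mem_filter, Finset.mem_univ, true_and] at hi
  exact hi.1.2.2

/-- **Registered credit (critic 1286 (c), PROVED):** every collar-pinned site is affinely deeply registered and in the window — the credit of R0ᴬ / RS
is a statement about REGISTERED pinned matter only; unregistered pinned matter is in `Gᶜ`, debited at `C`. [this file] -/
theorem affDeepReg_of_mem_collarPinned {ℓ rL Rc θ₀ ρ₁ ε₁ θ δ : ℝ} {y : Fin N → E3} {F : Finset (Fin N)} {j : Fin N}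
    (hj : j ∈ collarPinned ℓ rL Rc θ₀ ρ₁ ε₁ θ δ y F) : AffDeepReg ρ₁ ε₁ θ (1 / 450) y j ∧ InWindow δ 2 y j := by
  have hjN : j ∈ nearSet θ₀ ρ₁ ε₁ θ δ y :=
    nearInterior_subset_nearSet Rc θ₀ ρ₁ ε₁ θ δ y (collarPinned_subset ℓ rL Rc θ₀ ρ₁ ε₁ θ δ y F hj)
  unfold nearSet goodSet at hjN
  simp only [Finset.mem_filter, Finset.mem_univ, true_and] at hjN
  exact hjN.1

/-- The core at radius `D ≥ 2Rc` lies in the clampable interior. [this file] -/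
theorem nearCore_subset_nearInterior {D Rc θ₀ ρ₁ ε₁ θ δ : ℝ} (hRc : 0 ≤ Rc) (hD : 2 * Rc ≤ D) (y : Fin N → E3) :
    nearCore D θ₀ ρ₁ ε₁ θ δ y ⊆ nearInterior Rc θ₀ ρ₁ ε₁ θ δ y := by
  intro i hi
  rw [mem_nearCore] at hi
  unfold nearInterior
  rw [Finset.mem_filter]
  refine ⟨hi.1, fun j hj => hi.2 j (hj.trans ?_)⟩
  have hnn : nearestDist y i ≤ 2 := nearestDist_le_two_of_mem_nearSet hi.1
  nlinarith

/-- **KEY GEOMETRIC FACT (PROVED):** a near site with a NON-CLAMPABLE site within `2ℓ` lies in the shell of radius `2ℓ + 2Rc` (a non-clampable site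
is non-near, or near with a non-near site within `Rc·nn ≤ 2Rc`). [this file] -/
theorem mem_nearShell_of_nonclampable {ℓ Rc θ₀ ρ₁ ε₁ θ δ : ℝ} (hRc : 0 ≤ Rc) {y : Fin N → E3} {k b : Fin N}
    (hk : k ∈ nearSet θ₀ ρ₁ ε₁ θ δ y) (hb : b ∉ nearInterior Rc θ₀ ρ₁ ε₁ θ δ y) (hkb : dist (y k) (y b) ≤ 2 * ℓ) :
    k ∈ nearShell (2 * ℓ + 2 * Rc) θ₀ ρ₁ ε₁ θ δ y := by
  rw [mem_nearShell]
  refine ⟨hk, ?_⟩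
  by_cases hbN : b ∈ nearSet θ₀ ρ₁ ε₁ θ δ y
  · have hnc : ¬ ∀ j, dist (y j) (y b) ≤ Rc * nearestDist y b → j ∈ nearSet θ₀ ρ₁ ε₁ θ δ y := by
      intro h
      apply hb
      unfold nearInterior
      rw [Finset.mem_filter]
      exact ⟨hbN, h⟩
    push Not at hnc
    obtain ⟨j, hjb, hjN⟩ := hnc
    refine ⟨j, hjN, ?_⟩
    have hnn : nearestDist y b ≤ 2 := nearestDist_le_two_of_mem_nearSet hbN
    have h2 : Rc * nearestDist y b ≤ 2 * Rc := by nlinarith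
    calc dist (y j) (y k) ≤ dist (y j) (y b) + dist (y b) (y k) := dist_triangle _ _ _
      _ ≤ Rc * nearestDist y b + 2 * ℓ := by rw [dist_comm (y b) (y k)]; exact add_le_add hjb hkb
      _ ≤ 2 * ℓ + 2 * Rc := by linarith
  · refine ⟨b, hbN, ?_⟩
    rw [dist_comm]
    linarith

/-- **THE CREDIT LIVES IN THE SHELL (PROVED):** `collarPinned ⊆ nearShell (2ℓ + 2Rc)` — a collar-pinned site is not deep-pinned (else it would lie
in its own wall zone), so some non-clampable site is within `2ℓ`. [this file] -/
theorem collarPinned_subset_nearShell {ℓ rL Rc θ₀ ρ₁ ε₁ θ δ : ℝ} (hRc : 0 ≤ Rc) (hrL : 0 ≤ rL) (y : Fin N → E3) (F : Finset (Fin N)) :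
    collarPinned ℓ rL Rc θ₀ ρ₁ ε₁ θ δ y F ⊆ nearShell (2 * ℓ + 2 * Rc) θ₀ ρ₁ ε₁ θ δ y := by
  intro k hk
  obtain ⟨hkI, hkF, hkW⟩ := mem_collarPinned.mp hk
  have hkN : k ∈ nearSet θ₀ ρ₁ ε₁ θ δ y := nearInterior_subset_nearSet Rc θ₀ ρ₁ ε₁ θ δ y hkI
  have hnd : ¬ ∀ b, b ∉ nearInterior Rc θ₀ ρ₁ ε₁ θ δ y → 2 * ℓ < dist (y k) (y b) := by
    intro hdeep
    apply hkW
    unfold wallZone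
    rw [Finset.mem_filter]
    exact ⟨hkI, k, mem_deepPinned.mpr ⟨hkI, hkF, hdeep⟩, by rw [dist_self]; exact hrL⟩
  push Not at hnd
  obtain ⟨b, hb, hbd⟩ := hnd
  exact mem_nearShell_of_nonclampable hRc hkN hb hbd

/-- **THE CORE IS CELLS AND PRICED WALLS ONLY (PROVED):** `nearCore (2ℓ + 2Rc) ⊆ F ∪ wallZone` — a core site is clampable; if pinned it is deep-pinned
(no non-clampable site within `2ℓ`, else it would be in the shell), hence in the wall zone. [this file] -/
theorem nearCore_subset_free_union_wallZone {ℓ rL Rc θ₀ ρ₁ ε₁ θ δ : ℝ} (hℓ : 0 ≤ ℓ) (hRc : 0 ≤ Rc) (hrL : 0 ≤ rL)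
    (y : Fin N → E3) (F : Finset (Fin N)) :
    nearCore (2 * ℓ + 2 * Rc) θ₀ ρ₁ ε₁ θ δ y ⊆ F ∪ wallZone ℓ rL Rc θ₀ ρ₁ ε₁ θ δ y F := by
  intro i hi
  have hiI : i ∈ nearInterior Rc θ₀ ρ₁ ε₁ θ δ y := nearCore_subset_nearInterior hRc (by linarith) y hi
  rw [Finset.mem_union]
  by_cases hiF : i ∈ F
  · exact Or.inl hiF
  right
  by_cases hdeep : ∀ b, b ∉ nearInterior Rc θ₀ ρ₁ ε₁ θ δ y → 2 * ℓ < dist (y i) (y b)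
  · unfold wallZone
    rw [Finset.mem_filter]
    exact ⟨hiI, i, mem_deepPinned.mpr ⟨hiI, hiF, hdeep⟩, by rw [dist_self]; exact hrL⟩
  · exfalso
    push Not at hdeep
    obtain ⟨b, hb, hbd⟩ := hdeep
    have hsh := mem_nearShell_of_nonclampable hRc (nearCore_subset _ θ₀ ρ₁ ε₁ θ δ y hi) hb hbd
    exact Finset.disjoint_left.mp (disjoint_nearCore_nearShell (2 * ℓ + 2 * Rc) θ₀ ρ₁ ε₁ θ δ y) hi hsh

/-- **Degenerate case (PROVED):** a free set with no deep pinned site and no core-free site — in particular the EMPTY skeleton of `2ℓ`-thin near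
matter (`cellSkeleton_empty`) — has EMPTY core: the whole near class is shell, and RC is silent. [this file] -/
theorem nearCore_eq_empty_of_deepPinned_empty {ℓ rL Rc θ₀ ρ₁ ε₁ θ δ : ℝ} (hℓ : 0 ≤ ℓ) (hRc : 0 ≤ Rc) (hrL : 0 ≤ rL)
    {y : Fin N → E3} (h : deepPinned ℓ Rc θ₀ ρ₁ ε₁ θ δ y ∅ = ∅) :
    nearCore (2 * ℓ + 2 * Rc) θ₀ ρ₁ ε₁ θ δ y = ∅ := by
  have hsub : nearCore (2 * ℓ + 2 * Rc) θ₀ ρ₁ ε₁ θ δ y ⊆ ∅ ∪ wallZone ℓ rL Rc θ₀ ρ₁ ε₁ θ δ y ∅ :=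
    nearCore_subset_free_union_wallZone hℓ hRc hrL y ∅
  rw [wallZone_eq_empty_of_deepPinned_eq_empty h, Finset.empty_union] at hsub
  exact Finset.subset_empty.mp hsub

end Summit.AtomisticToContinuum.Crystallization.Theorems.OverbindingBudgetAffineNearCluster
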